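import Summits.QuantumFields.YangMills.Theorems.UnitScaleTiltProp7PinnedSupOfGradient
import HarnessLib

/-!
# Route `UnitScaleTilt`, crux K1 «MinimiserStabilityRegPr» (stmt-QuantumFields-19200), route-R E′ path (α′), (E1-b) — THE DOOR: the displayed row `hL : p (L A) ≤ C_L·q A` of
# ✓ `Prop7ExactCorrectorContractionGauge.exists_unique_exact_corrector_gauge` (px13 g3, (E1-d′)) for the linear corrector `L = LinCorr` in the knit's gauge
# `p ψ = max ‖ψ‖ (max (ℓ·‖D_Wψ‖) (ℓ·‖T₂ψ‖))` (✓ `Prop7GaugeRowsMaxSup`, X-row 3 := ρ₃ = ℓ·‖T₂ʷψ‖ of ✓ `Prop7ExactCorrectorGaugeSockets` §4) FOLLOWS FROM EXACTLY TWO ANALYTIC ROWS —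
# (hK) `‖D_W(LA)(x,μ)‖ ≤ c_I·ℓ·‖D*_WA‖_∞` and (hK₂) `‖T₂(LA)‖ ≤ c₂·ℓ·‖D*_WA‖_∞` — with `C_L := max (d·c_I∕2) (max c_I c₂)`; the zeroth-order row is ✓p670497, not an input

Cell `ym3-torus`, D-0154 (3c) twin-width seat `ym-routeR-w3` (gen 6) = namer of the (hK)∕(A)∕(E1-b) lineage (★routeR-w3 g5 HANDOFF §5; LOCATE-E1-CONTRACTION §3 (L), §7).  THE TARGET SIGNATURE OF
(E1-b), fixed by kernel: the (E1-e) knit (★p1) passes `L` (✓p670222 `Prop7LinearCorrectorMap.exists_linearCorrector_of_interp`), the gauge `p` (shape `hp` of ✓p667764) and ANY size `q` on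
bond fields dominating the divergence row (`ℓ²·‖D*_WA‖_∞ ≤ q A` — the `ℓ·‖A‖_∞` half of `‖A‖_Y` is never used, px7 g3 21:17:57Z); the two displayed rows are the deliverables of the covariant
(hK) chain (P-cov2, routeR-w6 g6: (R-cov) ✓p670099 ⇒ `hInterp`) and of the (hK₂:=ρ₃) chain (px7 g3 (hK₂-W) ✓p669609∕p670170∕⧗p671190 → covariant twin).  THEOREMS ONLY (0 `def`, 0 `sorry`);
`--supports stmt-QuantumFields-19200`, count-neutral.  YM₃ on T³ is a ladder rung (R3), not the Clay problem; nothing here claims the stub, the crux, d = 4 or the gap.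

WHAT IS PROVED (ns `…Theorems.Prop7LinearCorrectorBound`).
* §1 (pure max-algebra; `X E₁ E₂` seminormed groups, `Y` any type) ★ `gauge_apply_le_of_rows` — rows `‖L y‖ ≤ κ₀·‖T₁(L y)‖`, `‖T₁(L y)‖ ≤ c_I·ℓ·D y`, `‖T₂(L y)‖ ≤ c₂·ℓ·D y`,
  `ℓ²·D y ≤ q y`, `κ₀ ≤ κ·ℓ` ⇒ `p (L y) ≤ max (κ·c_I) (max c_I c₂) · q y`.
* §2 (the torus of record: `Site P 0`, `T := torusT P 0`, background `‖U‖, ‖U⁻¹‖ ≤ 1`, centres `range (embIter k)`, `k ≤ m + K`, `ℓ := L^k`; `T₁ψ := (μ, z) ↦ D_Uψ(z,μ)` in the `Pi` sup norm,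
  `T₂` ANY map into a seminormed group) ★★★ `linCorr_gauge_le_of_rows` — for ANY map `L` from bond fields to site fields whose values VANISH AT THE CENTRES, the rows
  (hK) `∀ A μ x, ‖D_U(L A)(x,μ)‖ ≤ c_I·ℓ·‖D*_UA‖_∞` and (hK₂) `∀ A, ‖T₂(L A)‖ ≤ c₂·ℓ·‖D*_UA‖_∞` give `∀ A, p (L A) ≤ max (d·c_I∕2) (max c_I c₂) · q A` — the door's `hL`.
  ★★ `linCorr_gauge_le_of_rows_T3` — the same with `‖U‖, ‖U⁻¹‖ ≤ 1` left displayed as ONE hypothesis `hU` (discharged at the member by ✓p668999 `unitsField_toUField_norm_le_one`).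
HONEST SCOPE.  Bookkeeping; (hK) and (hK₂) are DISPLAYED (their covariant suppliers are in flight; the flat model of both is closed: ✓p671212 `sup_regauge_le_of_rows_T3` rows (i)(v) and px7's
(hK₂-W)); the pinning of `L A` is px13's ✓ `linearCorrector_vanishes_on`.  Constants ours; nothing of print beyond the cited tree letters is asserted.

References: T. Bałaban, CMP 102 (1985) 277–309 [Balaban1985Variational] (Prop. 7 p.299); CMP 99 (1985) 75–102 [Balaban1985RegularSpaces] ((1.14) p.78, (1.36) p.82);
CMP 99 (1985) 389–434 [Balaban1985BackgroundPropagators] ((3.3) p.390, (3.8) p.392).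
-/

set_option autoImplicit false

noncomputable section

open scoped BigOperators

namespace Summit.QuantumFields.YangMills.Theorems.Prop7LinearCorrectorBound

open Literature.MathematicalPhysics.QuantumFieldTheory.Balaban1983to89
open B9Eq39Adjoint (covD divB)
open B9TorusCalculus (torusT)
open B15DeterminingSets (embIter)
open Summit.QuantumFields.YangMills.Theorems.Prop7PinnedSupOfGradient (norm_le_of_vanish_centres)

/-! ## §1 The max-algebra -/

section Algebra

variable {X E₁ E₂ Y : Type*} [SeminormedAddCommGroup X] [SeminormedAddCommGroup E₁] [SeminormedAddCommGroup E₂]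

/-- ★ **`hL` FROM THE ROWS, ABSTRACTLY**: for the gauge `p x = max ‖x‖ (max (ℓ·‖T₁x‖) (ℓ·‖T₂x‖))`, a map `L : Y → X`, a divergence size `D : Y → ℝ` and a size `q` with `ℓ²·D y ≤ q y`:
the rows `‖L y‖ ≤ κ₀·‖T₁(L y)‖` (zeroth order from first order, `κ₀ ≤ κ·ℓ`), `‖T₁(L y)‖ ≤ c_I·ℓ·D y` (first order), `‖T₂(L y)‖ ≤ c₂·ℓ·D y` (weighted second order) give
`p (L y) ≤ max (κ·c_I) (max c_I c₂) · q y`. [cite: Balaban1985Variational, Prop. 7 p.299] -/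
theorem gauge_apply_le_of_rows (p : X → ℝ) (T₁ : X → E₁) (T₂ : X → E₂) {ℓ : ℝ} (hℓ : 0 ≤ ℓ)
    (hp : ∀ x, p x = max ‖x‖ (max (ℓ * ‖T₁ x‖) (ℓ * ‖T₂ x‖)))
    (L : Y → X) (D q : Y → ℝ) (hD : ∀ y, 0 ≤ D y) (hq : ∀ y, ℓ ^ 2 * D y ≤ q y)
    {κ κ₀ cI c₂ : ℝ} (hκ : 0 ≤ κ) (hκ₀ : κ₀ ≤ κ * ℓ) (hcI : 0 ≤ cI) (hc₂ : 0 ≤ c₂)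
    (h0 : ∀ y, ‖L y‖ ≤ κ₀ * ‖T₁ (L y)‖) (h1 : ∀ y, ‖T₁ (L y)‖ ≤ cI * ℓ * D y) (h2 : ∀ y, ‖T₂ (L y)‖ ≤ c₂ * ℓ * D y) (y : Y) :
    p (L y) ≤ max (κ * cI) (max cI c₂) * q y := by
  have hq0 : 0 ≤ q y := (mul_nonneg (sq_nonneg ℓ) (hD y)).trans (hq y)
  have hDy := hD y
  set M : ℝ := max (κ * cI) (max cI c₂) with hM
  have hM1 : κ * cI ≤ M := le_max_left _ _
  have hM2 : cI ≤ M := (le_max_left _ _).trans (le_max_right _ _)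
  have hM3 : c₂ ≤ M := (le_max_right _ _).trans (le_max_right _ _)
  rw [hp]
  refine max_le ?_ (max_le ?_ ?_)
  · -- zeroth order: `‖L y‖ ≤ κ₀·c_I·ℓ·D y ≤ κ·c_I·ℓ²·D y ≤ κ·c_I·q y`
    have hT1 : 0 ≤ ‖T₁ (L y)‖ := norm_nonneg _
    calc ‖L y‖ ≤ κ₀ * ‖T₁ (L y)‖ := h0 y
      _ ≤ κ * ℓ * ‖T₁ (L y)‖ := mul_le_mul_of_nonneg_right hκ₀ hT1
      _ ≤ κ * ℓ * (cI * ℓ * D y) := mul_le_mul_of_nonneg_left (h1 y) (mul_nonneg hκ hℓ)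
      _ = κ * cI * (ℓ ^ 2 * D y) := by ring
      _ ≤ κ * cI * q y := mul_le_mul_of_nonneg_left (hq y) (mul_nonneg hκ hcI)
      _ ≤ M * q y := mul_le_mul_of_nonneg_right hM1 hq0
  · calc ℓ * ‖T₁ (L y)‖ ≤ ℓ * (cI * ℓ * D y) := mul_le_mul_of_nonneg_left (h1 y) hℓ
      _ = cI * (ℓ ^ 2 * D y) := by ring
      _ ≤ cI * q y := mul_le_mul_of_nonneg_left (hq y) hcI
      _ ≤ M * q y := mul_le_mul_of_nonneg_right hM2 hq0
  · calc ℓ * ‖T₂ (L y)‖ ≤ ℓ * (c₂ * ℓ * D y) := mul_le_mul_of_nonneg_left (h2 y) hℓ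
      _ = c₂ * (ℓ ^ 2 * D y) := by ring
      _ ≤ c₂ * q y := mul_le_mul_of_nonneg_left (hq y) hc₂
      _ ≤ M * q y := mul_le_mul_of_nonneg_right hM3 hq0

end Algebra

/-! ## §2 On the torus of record: `hL` from (hK) and (hK₂) -/

section Torus

variable {P : Params} {𝔸 : Type*} [NormedRing 𝔸] {E₂ : Type*} [SeminormedAddCommGroup E₂]

/-- ★★★ **THE (E1-b) DOOR**: on `Site P 0` with shifts `torusT`, background `‖U‖, ‖U⁻¹‖ ≤ 1`, centres `range (embIter k)` (`k ≤ m + K`), `ℓ := L^k`; gauge `p ψ = max ‖ψ‖ (max (ℓ·‖D_Uψ‖) (ℓ·‖T₂ψ‖))`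
(`D_Uψ` as the `Pi`-normed field `(μ, z) ↦ D_{U,μ}ψ(z)`, `T₂` any map into a seminormed group — the knit's weighted Laplacian `T₂ʷ`); size `q` with `ℓ²·‖D*_UA‖_∞ ≤ q A`; a corrector `L` whose values
vanish at the centres.  Then the two rows (hK) `‖D_U(L A)(z,μ)‖ ≤ c_I·ℓ·‖D*_UA‖_∞`, (hK₂) `‖T₂(L A)‖ ≤ c₂·ℓ·‖D*_UA‖_∞` give the door's `hL`: `p (L A) ≤ max (d·c_I∕2) (max c_I c₂) · q A`.
[cite: Balaban1985Variational, Prop. 7 p.299; Balaban1985RegularSpaces, (1.36) p.82, (1.14) p.78; Balaban1985BackgroundPropagators, (3.8) p.392] -/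
theorem linCorr_gauge_le_of_rows {k : ℕ} (hk : k ≤ P.m + P.K) (U : Fin P.d → Site P 0 → 𝔸ˣ)
    (hU : ∀ (κ : Fin P.d) (y : Site P 0), ‖(U κ y : 𝔸)‖ ≤ 1 ∧ ‖(((U κ y)⁻¹ : 𝔸ˣ) : 𝔸)‖ ≤ 1)
    (T₂ : (Site P 0 → 𝔸) → E₂) (p : (Site P 0 → 𝔸) → ℝ)
    (hp : ∀ ψ, p ψ = max ‖ψ‖ (max ((P.L : ℝ) ^ k * ‖(fun μ z => covD (torusT P 0) U μ ψ z)‖) ((P.L : ℝ) ^ k * ‖T₂ ψ‖)))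
    (q : (Fin P.d → Site P 0 → 𝔸) → ℝ) (hq : ∀ A, ((P.L : ℝ) ^ k) ^ 2 * ‖(fun x => divB (torusT P 0) U A x)‖ ≤ q A)
    (L : (Fin P.d → Site P 0 → 𝔸) → (Site P 0 → 𝔸)) (hLC : ∀ (A) (y : Site P k), L A (embIter k y) = 0)
    {cI c₂ : ℝ} (hcI : 0 ≤ cI) (hc₂ : 0 ≤ c₂)
    (hK : ∀ (A) (μ : Fin P.d) (x : Site P 0), ‖covD (torusT P 0) U μ (L A) x‖ ≤ cI * (P.L : ℝ) ^ k * ‖(fun x => divB (torusT P 0) U A x)‖)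
    (hK₂ : ∀ A, ‖T₂ (L A)‖ ≤ c₂ * (P.L : ℝ) ^ k * ‖(fun x => divB (torusT P 0) U A x)‖) (A : Fin P.d → Site P 0 → 𝔸) :
    p (L A) ≤ max ((P.d : ℝ) / 2 * cI) (max cI c₂) * q A := by
  have hℓ : (0 : ℝ) ≤ (P.L : ℝ) ^ k := pow_nonneg (Nat.cast_nonneg _) k
  -- first order, in the `Pi` norm
  have h1 : ∀ B, ‖(fun μ z => covD (torusT P 0) U μ (L B) z)‖ ≤ cI * (P.L : ℝ) ^ k * ‖(fun x => divB (torusT P 0) U B x)‖ := by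
    intro B
    have h0 : 0 ≤ cI * (P.L : ℝ) ^ k * ‖(fun x => divB (torusT P 0) U B x)‖ := by positivity
    refine (pi_norm_le_iff_of_nonneg h0).mpr fun μ => (pi_norm_le_iff_of_nonneg h0).mpr fun x => hK B μ x
  -- zeroth order from first order (✓p670497), in the `Pi` norm
  have h0 : ∀ B, ‖L B‖ ≤ (P.d : ℝ) / 2 * (P.L : ℝ) ^ k * ‖(fun μ z => covD (torusT P 0) U μ (L B) z)‖ := by
    intro B
    have ha : ∀ (μ : Fin P.d) (x : Site P 0), ‖covD (torusT P 0) U μ (L B) x‖ ≤ ‖(fun μ z => covD (torusT P 0) U μ (L B) z)‖ := fun μ x =>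
      (norm_le_pi_norm ((fun μ z => covD (torusT P 0) U μ (L B) z) μ) x).trans (norm_le_pi_norm (fun μ z => covD (torusT P 0) U μ (L B) z) μ)
    have hb : 0 ≤ (P.d : ℝ) / 2 * (P.L : ℝ) ^ k * ‖(fun μ z => covD (torusT P 0) U μ (L B) z)‖ := by positivity
    exact (pi_norm_le_iff_of_nonneg hb).mpr fun x => norm_le_of_vanish_centres hk U hU (L B) (hLC B) ha x
  have hκ : (0 : ℝ) ≤ (P.d : ℝ) / 2 := by positivity
  exact gauge_apply_le_of_rows p (fun ψ => (fun μ z => covD (torusT P 0) U μ ψ z)) T₂ hℓ hp L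
    (fun B => ‖(fun x => divB (torusT P 0) U B x)‖) q (fun B => norm_nonneg _) hq hκ le_rfl hcI hc₂ h0 h1 hK₂ A

/-- ★★ **THE (E1-b) DOOR, `hL` AS THE KNIT CONSUMES IT**: the conclusion quantified over all `A` (the shape `∀ y, p (L y) ≤ C_L * q y` of ✓ `exists_unique_exact_corrector_gauge`), with
`C_L := max (d·c_I∕2) (max c_I c₂)`.  At the member the background rows `hU` are ✓ `Prop7ExactCorrectorGaugeSockets.unitsField_toUField_norm_le_one` and the pinning `hLC` is
✓ `Prop7LinearCorrectorMap.linearCorrector_vanishes_on`. [cite: Balaban1985Variational, Prop. 7 p.299; Balaban1985RegularSpaces, (1.36) p.82] -/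
theorem linCorr_gauge_le_of_rows_T3 {k : ℕ} (hk : k ≤ P.m + P.K) (U : Fin P.d → Site P 0 → 𝔸ˣ)
    (hU : ∀ (κ : Fin P.d) (y : Site P 0), ‖(U κ y : 𝔸)‖ ≤ 1 ∧ ‖(((U κ y)⁻¹ : 𝔸ˣ) : 𝔸)‖ ≤ 1)
    (T₂ : (Site P 0 → 𝔸) → E₂) (p : (Site P 0 → 𝔸) → ℝ)
    (hp : ∀ ψ, p ψ = max ‖ψ‖ (max ((P.L : ℝ) ^ k * ‖(fun μ z => covD (torusT P 0) U μ ψ z)‖) ((P.L : ℝ) ^ k * ‖T₂ ψ‖)))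
    (q : (Fin P.d → Site P 0 → 𝔸) → ℝ) (hq : ∀ A, ((P.L : ℝ) ^ k) ^ 2 * ‖(fun x => divB (torusT P 0) U A x)‖ ≤ q A)
    (L : (Fin P.d → Site P 0 → 𝔸) → (Site P 0 → 𝔸)) (hLC : ∀ (A) (y : Site P k), L A (embIter k y) = 0)
    {cI c₂ : ℝ} (hcI : 0 ≤ cI) (hc₂ : 0 ≤ c₂)
    (hK : ∀ (A) (μ : Fin P.d) (x : Site P 0), ‖covD (torusT P 0) U μ (L A) x‖ ≤ cI * (P.L : ℝ) ^ k * ‖(fun x => divB (torusT P 0) U A x)‖)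
    (hK₂ : ∀ A, ‖T₂ (L A)‖ ≤ c₂ * (P.L : ℝ) ^ k * ‖(fun x => divB (torusT P 0) U A x)‖) :
    ∃ C_L : ℝ, 0 ≤ C_L ∧ C_L = max ((P.d : ℝ) / 2 * cI) (max cI c₂) ∧ ∀ A, p (L A) ≤ C_L * q A :=
  ⟨_, (hcI.trans (le_max_left _ _)).trans (le_max_right _ _), rfl,
    fun A => linCorr_gauge_le_of_rows hk U hU T₂ p hp q hq L hLC hcI hc₂ hK hK₂ A⟩

end Torus

end Summit.QuantumFields.YangMills.Theorems.Prop7LinearCorrectorBound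

end
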